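import Literature.Probability.RandomPlanarGeometry.SAWIrreducibleBridgeThreeSpanSlack
import Literature.Probability.RandomPlanarGeometry.SAWPulledLargeForceExpansionZdFifthOrder
import HarnessLib

/-!
# Pulled SAW on `ℤ^{d+1}`: the SUB-EXTREMAL irreducible bridges — `N_{2A+1,3A+1} = (3A − 2)·2d(2d−1)²` for every `A ≥ 2`

Topic `Literature/Probability/RandomPlanarGeometry` (continues `SAWIrreducibleBridgeThreeSpanSlack.lean`: the forced height words at
length `3A + 1`, and `SAWPulledLargeForceExpansionZdFifthOrder.lean`: `N_{5,7} = 4·2d(2d−1)²`, the case `A = 2` below).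

THE NEXT-TO-TOP COEFFICIENT. An irreducible bridge of `ℤ^{d+1}` of span `A ≥ 2` has length `≥ 3A` (three-span lemma); at length
`3A + 1` (cost `2A + 1`) it has exactly THREE transverse steps: the two turn plateaus of the staple `U^A T D^{A−1} T U^{A−1}` and one
more, inserted at a slot `σ` — before the top (`1 ≤ σ ≤ A`; `σ = A` doubles the top plateau), strictly inside the descent
(`A + 2 ≤ σ ≤ 2A − 1`), or after the bottom turn (`2A + 1 ≤ σ ≤ 3A`; `σ = 2A + 1` doubles the bottom plateau, `σ = 3A` is a final
transverse step): `3A − 2` height words `subH A σ`, each realised by exactly `2d(2d−1)²` walks (three transverse steps, consecutive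
ones non-reversing — the reversals are excluded by self-avoidance, nothing else is). Hence the next-to-top coefficient of every odd
cost polynomial of the large-force expansion: `N_{2A+1,3A+1}(ℤ^{d+1}) = (3A − 2)·2d(2d−1)²` (`A = 2`: `N_{5,7} = 4·2d(2d−1)²`;
`A = 3`: `N_{7,10} = 7·2d(2d−1)²`, …), complementing the top coefficients `N_{2A,3A} = 2d(2d−1)` of the even ones.
The families are TABLE-DRIVEN (as the hooks of the fifth-order file) with ARITHMETIC tables valid for every `A`; the converse rests on
the one-slack profile theorem `heights_of_length_eq_three_mul_span_add_one`.
[cite: MadrasSlade1993, §4.2, remark after Theorem 4.2.4 (p. 94)] [cite: DuminilCopinHammond2013, §2.2]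

## Contents (namespace `Literature.Probability.RandomPlanarGeometry.SAW.Zd`; standard axioms, no sorry)
tables `stapleTN`, `subT`, slots `subSlots` (`#subSlots A = 3A − 2`) and their arithmetic facts; the walks `subStaple d A σ (v,w,x)`;
`subStaple_mem_saws`, `subStaple_mem_filter`, `subStaple_injective`, `subStaple_slot_eq`; `le_costCoeffZd_two_mul_add_one` (lower bound);
`exists_eq_subStaple_of_heights`, ★ `eq_subStaple_of_mem` (converse), `filter_costZd_subStaple_eq`,
★★ **`costCoeffZd_two_mul_add_one_three_mul_add_one`** : `N_{2A+1,3A+1} = (3A − 2)·2d(2d−1)²` (`A ≥ 2`).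
Lane «pcv-sawmu» (a-p3 g16, 2026-08-24).
-/

noncomputable section

open Finset
open scoped BigOperators
open Literature.Probability.LatticeModels
open Literature.Probability.RandomPlanarGeometry.SAW

namespace Literature.Probability.RandomPlanarGeometry.SAW.Zd

/-! ### The arithmetic tables -/

/-- Staple transverse counts: `0` (`j ≤ A`), `1` (`A < j ≤ 2A`), `2` beyond. [cite: MadrasSlade1993, Definition 1.2.4] -/
def stapleTN (A j : ℕ) : ℕ := if j ≤ A then 0 else if j ≤ 2 * A then 1 else 2

/-- Transverse counts of the same: one extra transverse step after slot `σ`. [cite: MadrasSlade1993, Definition 1.2.4] -/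
def subT (A σ i : ℕ) : ℕ := stapleTN A (if i ≤ σ then i else i - 1) + (if σ < i then 1 else 0)

/-- The admissible slots: `1 ≤ σ ≤ 3A`, `σ ≠ A + 1`, `σ ≠ 2A` (canonical representatives of the `3A − 2` words: the slots `A`/`A+1`,
resp. `2A`/`2A+1`, give the same word). [cite: MadrasSlade1993, Definition 1.2.4] -/
def subSlots (A : ℕ) : Finset ℕ := (Finset.range (3 * A + 1)).filter fun σ => 1 ≤ σ ∧ σ ≠ A + 1 ∧ σ ≠ 2 * A

/-! ### Table facts (arithmetic, every `A`, `σ ∈ subSlots A`) -/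

/-- Membership in `subSlots`. [cite: MadrasSlade1993, Definition 1.2.4] -/
theorem mem_subSlots {A σ : ℕ} : σ ∈ subSlots A ↔ σ ≤ 3 * A ∧ 1 ≤ σ ∧ σ ≠ A + 1 ∧ σ ≠ 2 * A := by
  simp only [subSlots, Finset.mem_filter, Finset.mem_range]; omega

/-- `#subSlots A = 3A − 2` (`A ≥ 2`). [cite: MadrasSlade1993, Definition 1.2.4] -/
theorem card_subSlots {A : ℕ} (hA : 2 ≤ A) : (subSlots A).card = 3 * A - 2 := by
  have : subSlots A = ((Finset.Icc 1 (3 * A)).erase (A + 1)).erase (2 * A) := by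
    ext σ; simp only [mem_subSlots, Finset.mem_erase, Finset.mem_Icc]; omega
  rw [this, Finset.card_erase_of_mem (by simp only [Finset.mem_erase, Finset.mem_Icc]; omega),
    Finset.card_erase_of_mem (by simp only [Finset.mem_Icc]; omega), Nat.card_Icc]
  omega

/-- Ends: `H 0 = 0`, `T 0 = 0`, `H (3A+1) = A`, `T (3A+1) = 3`, and frozen beyond. [cite: MadrasSlade1993, Definition 1.2.4] -/
theorem sub_table_ends {A σ : ℕ} (hσ : σ ∈ subSlots A) :
    subH A σ 0 = 0 ∧ subT A σ 0 = 0 ∧ subH A σ (3 * A + 1) = A ∧ subT A σ (3 * A + 1) = 3 ∧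
      ∀ i, 3 * A + 1 ≤ i → subH A σ i = A ∧ subT A σ i = 3 := by
  rw [mem_subSlots] at hσ
  refine ⟨?_, ?_, ?_, ?_, fun i hi => ⟨?_, ?_⟩⟩ <;> simp only [subH, subT, stapleHN, stapleTN] <;> split_ifs <;> omega

/-- Bridge range: `1 ≤ H i ≤ A` for `1 ≤ i`. [cite: MadrasSlade1993, Definition 1.2.4] -/
theorem sub_table_bridge {A σ : ℕ} (hσ : σ ∈ subSlots A) {i : ℕ} (hi : 1 ≤ i) : 1 ≤ subH A σ i ∧ subH A σ i ≤ A := by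
  rw [mem_subSlots] at hσ
  simp only [subH, stapleHN]; split_ifs <;> omega

/-- `T i ≤ 3`. [cite: MadrasSlade1993, Definition 1.2.4] -/
theorem sub_table_T_le {A σ : ℕ} (i : ℕ) : subT A σ i ≤ 3 := by
  simp only [subT, stapleTN]; split_ifs <;> omega

/-- Steps: up, down or transverse (with `T ≤ 2` before a transverse step). [cite: MadrasSlade1993, Definition 1.2.4] -/
theorem sub_table_step {A σ : ℕ} (hσ : σ ∈ subSlots A) {i : ℕ} (hi : i ≤ 3 * A) :
    (subH A σ (i + 1) = subH A σ i + 1 ∧ subT A σ (i + 1) = subT A σ i) ∨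
    (subH A σ (i + 1) + 1 = subH A σ i ∧ subT A σ (i + 1) = subT A σ i) ∨
    (subH A σ (i + 1) = subH A σ i ∧ subT A σ (i + 1) = subT A σ i + 1 ∧ subT A σ i ≤ 2) := by
  rw [mem_subSlots] at hσ
  simp only [subH, subT, stapleHN, stapleTN]; split_ifs <;> omega

/-- `(H, T)` is injective on `[0, 3A+1]`. [cite: MadrasSlade1993, Definition 1.2.4] -/
theorem sub_table_inj {A σ : ℕ} (hσ : σ ∈ subSlots A) {i j : ℕ} (hi : i ≤ 3 * A + 1) (hj : j ≤ 3 * A + 1)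
    (hH : subH A σ i = subH A σ j) (hT : subT A σ i = subT A σ j) : i = j := by
  rw [mem_subSlots] at hσ
  simp only [subH, subT, stapleHN, stapleTN] at hH hT; split_ifs at hH hT <;> omega

/-- No renewal time: for `1 ≤ k ≤ 3A` either an earlier height exceeds `H k` or a later one is `≤ H k`. [cite: DuminilCopinHammond2013, §2.2] -/
theorem sub_table_noRenewal {A σ : ℕ} (hσ : σ ∈ subSlots A) {k : ℕ} (hk1 : 1 ≤ k) (hk : k ≤ 3 * A) :
    ¬ ((∀ i, 1 ≤ i → i ≤ k → subH A σ i ≤ subH A σ k) ∧ (∀ j, 1 ≤ j → j ≤ 3 * A + 1 - k → subH A σ k < subH A σ (k + j))) := by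
  have hσ' := mem_subSlots.1 hσ
  rintro ⟨hle, hlt⟩
  have hAk : subH A σ (A + 1) = A := by simp only [subH, stapleHN]; split_ifs <;> omega
  have hB : subH A σ (2 * A + 1) = 1 := by simp only [subH, stapleHN]; split_ifs <;> omega
  obtain ⟨hk1', hkA⟩ := sub_table_bridge hσ hk1
  rcases hkA.lt_or_eq with hlt' | heq
  · rcases Nat.lt_or_ge k (A + 1) with hkA1 | hkA1
    · have := hlt (2 * A + 1 - k) (by omega) (by omega)
      rw [show k + (2 * A + 1 - k) = 2 * A + 1 by omega, hB] at this
      omega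
    · have := hle (A + 1) (by omega) hkA1
      omega
  · have := hlt 1 le_rfl (by omega)
    have h2 := (sub_table_bridge hσ (show 1 ≤ k + 1 by omega)).2
    omega

/-- Each table takes the transverse counts `1` and `2` somewhere in `[0, 3A+1]`. [cite: MadrasSlade1993, Definition 1.2.4] -/
theorem sub_table_T_hits {A σ : ℕ} (hσ : σ ∈ subSlots A) :
    (∃ i, i ≤ 3 * A + 1 ∧ subT A σ i = 1) ∧ (∃ i, i ≤ 3 * A + 1 ∧ subT A σ i = 2) := by
  have hσ' := mem_subSlots.1 hσ
  constructor
  · rcases Nat.lt_or_ge σ (A + 1) with h1 | h1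
    · exact ⟨σ + 1, by omega, by simp only [subT, stapleTN]; split_ifs <;> omega⟩
    · exact ⟨A + 1, by omega, by simp only [subT, stapleTN]; split_ifs <;> omega⟩
  · rcases Nat.lt_or_ge σ (A + 1) with h1 | h1
    · exact ⟨A + 2, by omega, by simp only [subT, stapleTN]; split_ifs <;> omega⟩
    rcases Nat.lt_or_ge σ (2 * A + 1) with h2 | h2
    · exact ⟨σ + 1, by omega, by simp only [subT, stapleTN]; split_ifs <;> omega⟩
    · exact ⟨2 * A + 1, by omega, by simp only [subT, stapleTN]; split_ifs <;> omega⟩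

/-- `subH` before the slot. [cite: MadrasSlade1993, Definition 1.2.4] -/
theorem subH_of_le {A σ i : ℕ} (h : i ≤ σ) : subH A σ i = stapleHN A i := by
  rw [subH, if_pos h]

/-- `subH` after the slot. [cite: MadrasSlade1993, Definition 1.2.4] -/
theorem subH_of_lt {A σ i : ℕ} (h : σ < i) : subH A σ i = stapleHN A (i - 1) := by
  rw [subH, if_neg (by omega)]

/-- `subT` before the slot. [cite: MadrasSlade1993, Definition 1.2.4] -/
theorem subT_of_le {A σ i : ℕ} (h : i ≤ σ) : subT A σ i = stapleTN A i := by
  rw [subT, if_pos h, if_neg (by omega), Nat.add_zero]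

/-- `subT` after the slot. [cite: MadrasSlade1993, Definition 1.2.4] -/
theorem subT_of_lt {A σ i : ℕ} (h : σ < i) : subT A σ i = stapleTN A (i - 1) + 1 := by
  rw [subT, if_neg (by omega), if_pos h]

/-- Different slots give different height words (`A ≥ 2`). [cite: MadrasSlade1993, Definition 1.2.4] -/
theorem sub_table_sep {A σ σ' : ℕ} (hA : 2 ≤ A) (hσ : σ ∈ subSlots A) (hσ' : σ' ∈ subSlots A)
    (h : ∀ i, i ≤ 3 * A + 1 → subH A σ i = subH A σ' i) : σ = σ' := by
  have h1 := mem_subSlots.1 hσ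
  have h2 := mem_subSlots.1 hσ'
  by_contra hne
  wlog hlt : σ < σ' generalizing σ σ'
  · exact this hσ' hσ (fun i hi => (h i hi).symm) h2 h1 (Ne.symm hne) (by omega)
  have e1 := h (σ + 1) (by omega)
  rw [subH_of_lt (show σ < σ + 1 by omega), subH_of_le (show σ + 1 ≤ σ' by omega), Nat.add_sub_cancel] at e1
  have hσA : σ = A := by
    simp only [stapleHN] at e1; split_ifs at e1 <;> omega
  have e2 := h (σ + 2) (by omega)
  rw [subH_of_lt (show σ < σ + 2 by omega), subH_of_le (show σ + 2 ≤ σ' by omega), show σ + 2 - 1 = σ + 1 by omega] at e2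
  simp only [stapleHN] at e2; split_ifs at e2 <;> omega

/-- The three transverse times of the table, case `₁`. [cite: MadrasSlade1993, Definition 1.2.4] -/
private theorem sub_table_tt₁ {A σ : ℕ} (hσ : σ ∈ subSlots A) (h1 : σ < A + 1) :
    (subT A σ σ = 0 ∧ subT A σ (σ + 1) = 1 ∧ subH A σ (σ + 1) = subH A σ σ) ∧
      (subT A σ (A + 1) = 1 ∧ subT A σ ((A + 1) + 1) = 2 ∧ subH A σ ((A + 1) + 1) = subH A σ (A + 1)) ∧
      (subT A σ (2 * A + 1) = 2 ∧ subT A σ ((2 * A + 1) + 1) = 3 ∧ subH A σ ((2 * A + 1) + 1) = subH A σ (2 * A + 1)) := by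
  have hσ' := mem_subSlots.1 hσ
  refine ⟨⟨?_, ?_, ?_⟩, ⟨?_, ?_, ?_⟩, ⟨?_, ?_, ?_⟩⟩
  · rw [subT_of_le le_rfl]; simp only [stapleTN]; split_ifs <;> omega
  · rw [subT_of_lt (Nat.lt_succ_self σ)]; simp only [stapleTN]; split_ifs <;> omega
  · rw [subH_of_lt (Nat.lt_succ_self σ), subH_of_le le_rfl]; simp only [stapleHN]; split_ifs <;> omega
  · rw [subT_of_lt (by omega)]; simp only [stapleTN]; split_ifs <;> omega
  · rw [subT_of_lt (by omega)]; simp only [stapleTN]; split_ifs <;> omega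
  · rw [subH_of_lt (by omega), subH_of_lt (by omega)]; simp only [stapleHN]; split_ifs <;> omega
  · rw [subT_of_lt (by omega)]; simp only [stapleTN]; split_ifs <;> omega
  · rw [subT_of_lt (by omega)]; simp only [stapleTN]; split_ifs <;> omega
  · rw [subH_of_lt (by omega), subH_of_lt (by omega)]; simp only [stapleHN]; split_ifs <;> omega

/-- The three transverse times of the table, case `₂`. [cite: MadrasSlade1993, Definition 1.2.4] -/
private theorem sub_table_tt₂ {A σ : ℕ} (hσ : σ ∈ subSlots A) (h1 : A + 1 ≤ σ) (h2 : σ < 2 * A + 1) :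
    (subT A σ A = 0 ∧ subT A σ (A + 1) = 1 ∧ subH A σ (A + 1) = subH A σ A) ∧
      (subT A σ σ = 1 ∧ subT A σ (σ + 1) = 2 ∧ subH A σ (σ + 1) = subH A σ σ) ∧
      (subT A σ (2 * A + 1) = 2 ∧ subT A σ ((2 * A + 1) + 1) = 3 ∧ subH A σ ((2 * A + 1) + 1) = subH A σ (2 * A + 1)) := by
  have hσ' := mem_subSlots.1 hσ
  refine ⟨⟨?_, ?_, ?_⟩, ⟨?_, ?_, ?_⟩, ⟨?_, ?_, ?_⟩⟩
  · rw [subT_of_le (by omega)]; simp only [stapleTN]; split_ifs <;> omega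
  · rw [subT_of_le (by omega)]; simp only [stapleTN]; split_ifs <;> omega
  · rw [subH_of_le (by omega), subH_of_le (by omega)]; simp only [stapleHN]; split_ifs <;> omega
  · rw [subT_of_le le_rfl]; simp only [stapleTN]; split_ifs <;> omega
  · rw [subT_of_lt (Nat.lt_succ_self σ)]; simp only [stapleTN]; split_ifs <;> omega
  · rw [subH_of_lt (Nat.lt_succ_self σ), subH_of_le le_rfl]; simp only [stapleHN]; split_ifs <;> omega
  · rw [subT_of_lt (by omega)]; simp only [stapleTN]; split_ifs <;> omega
  · rw [subT_of_lt (by omega)]; simp only [stapleTN]; split_ifs <;> omega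
  · rw [subH_of_lt (by omega), subH_of_lt (by omega)]; simp only [stapleHN]; split_ifs <;> omega

/-- The three transverse times of the table, case `₃`. [cite: MadrasSlade1993, Definition 1.2.4] -/
private theorem sub_table_tt₃ {A σ : ℕ} (hσ : σ ∈ subSlots A) (h2 : 2 * A + 1 ≤ σ) :
    (subT A σ A = 0 ∧ subT A σ (A + 1) = 1 ∧ subH A σ (A + 1) = subH A σ A) ∧
      (subT A σ (2 * A) = 1 ∧ subT A σ ((2 * A) + 1) = 2 ∧ subH A σ ((2 * A) + 1) = subH A σ (2 * A)) ∧
      (subT A σ σ = 2 ∧ subT A σ (σ + 1) = 3 ∧ subH A σ (σ + 1) = subH A σ σ) := by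
  have hσ' := mem_subSlots.1 hσ
  refine ⟨⟨?_, ?_, ?_⟩, ⟨?_, ?_, ?_⟩, ⟨?_, ?_, ?_⟩⟩
  · rw [subT_of_le (by omega)]; simp only [stapleTN]; split_ifs <;> omega
  · rw [subT_of_le (by omega)]; simp only [stapleTN]; split_ifs <;> omega
  · rw [subH_of_le (by omega), subH_of_le (by omega)]; simp only [stapleHN]; split_ifs <;> omega
  · rw [subT_of_le (by omega)]; simp only [stapleTN]; split_ifs <;> omega
  · rw [subT_of_le (by omega)]; simp only [stapleTN]; split_ifs <;> omega
  · rw [subH_of_le (by omega), subH_of_le (by omega)]; simp only [stapleHN]; split_ifs <;> omega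
  · rw [subT_of_le le_rfl]; simp only [stapleTN]; split_ifs <;> omega
  · rw [subT_of_lt (Nat.lt_succ_self σ)]; simp only [stapleTN]; split_ifs <;> omega
  · rw [subH_of_lt (Nat.lt_succ_self σ), subH_of_le le_rfl]; simp only [stapleHN]; split_ifs <;> omega

/-- The transverse steps of the table happen at the three explicit times. [cite: MadrasSlade1993, Definition 1.2.4] -/
theorem sub_table_tr {A σ : ℕ} {i : ℕ} (h : subT A σ (i + 1) = subT A σ i + 1) :
    i = (if σ ≤ A then σ else A) ∨ i = (if σ ≤ A then A + 1 else if σ ≤ 2 * A then σ else 2 * A) ∨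
      i = (if σ ≤ 2 * A then 2 * A + 1 else σ) := by
  simp only [subT, stapleTN] at h
  split_ifs at h ⊢ <;> omega

/-- The three transverse times `t₀ < t₁ < t₂ ≤ 3A` of the table (with `T(t_j) = j`, equal heights across each), and every transverse
step of the table is one of them. [cite: MadrasSlade1993, Definition 1.2.4] -/
theorem sub_table_tt {A σ : ℕ} (hσ : σ ∈ subSlots A) :
    ∃ t₀ t₁ t₂ : ℕ, t₀ < t₁ ∧ t₁ < t₂ ∧ t₂ ≤ 3 * A ∧
      (subT A σ t₀ = 0 ∧ subT A σ (t₀ + 1) = 1 ∧ subH A σ (t₀ + 1) = subH A σ t₀) ∧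
      (subT A σ t₁ = 1 ∧ subT A σ (t₁ + 1) = 2 ∧ subH A σ (t₁ + 1) = subH A σ t₁) ∧
      (subT A σ t₂ = 2 ∧ subT A σ (t₂ + 1) = 3 ∧ subH A σ (t₂ + 1) = subH A σ t₂) ∧
      ∀ i, i ≤ 3 * A → subT A σ (i + 1) = subT A σ i + 1 → i = t₀ ∨ i = t₁ ∨ i = t₂ := by
  have hσ' := mem_subSlots.1 hσ
  rcases Nat.lt_or_ge σ (A + 1) with h1 | h1
  · obtain ⟨f0, f1, f2⟩ := sub_table_tt₁ hσ h1
    refine ⟨σ, A + 1, 2 * A + 1, by omega, by omega, by omega, f0, f1, f2, fun i _ h => ?_⟩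
    have := sub_table_tr h
    rwa [if_pos (by omega), if_pos (by omega), if_pos (by omega)] at this
  rcases Nat.lt_or_ge σ (2 * A + 1) with h2 | h2
  · obtain ⟨f0, f1, f2⟩ := sub_table_tt₂ hσ h1 h2
    refine ⟨A, σ, 2 * A + 1, by omega, by omega, by omega, f0, f1, f2, fun i _ h => ?_⟩
    have := sub_table_tr h
    rwa [if_neg (by omega), if_neg (by omega), if_pos (by omega), if_pos (by omega)] at this
  · obtain ⟨f0, f1, f2⟩ := sub_table_tt₃ hσ h2
    refine ⟨A, 2 * A, σ, by omega, by omega, by omega, f0, f1, f2, fun i _ h => ?_⟩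
    have := sub_table_tr h
    rwa [if_neg (by omega), if_neg (by omega), if_neg (by omega), if_neg (by omega)] at this

/-- A site of the `T = 0` phase and a site of the `T = 2` phase at the same height (they coincide if `w = −v`). [cite: MadrasSlade1993, Definition 1.2.4] -/
theorem sub_table_vw {A σ : ℕ} (hσ : σ ∈ subSlots A) :
    ∃ i j, i < j ∧ j ≤ 3 * A + 1 ∧ subT A σ i = 0 ∧ subT A σ j = 2 ∧ subH A σ i = subH A σ j := by
  have hσ' := mem_subSlots.1 hσ
  rcases Nat.lt_or_ge σ (A + 1) with h1 | h1
  · refine ⟨σ, 2 * A + 2 - σ, by omega, by omega, ?_, ?_, ?_⟩ <;>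
      simp only [subT, subH, stapleTN, stapleHN] <;> split_ifs <;> omega
  · refine ⟨1, 2 * A + 1, by omega, by omega, ?_, ?_, ?_⟩ <;>
      simp only [subT, subH, stapleTN, stapleHN] <;> split_ifs <;> omega

/-- A site of the `T = 1` phase and a site of the `T = 3` phase at the same height (they coincide if `x = −w`). [cite: MadrasSlade1993, Definition 1.2.4] -/
theorem sub_table_wx {A σ : ℕ} (hσ : σ ∈ subSlots A) :
    ∃ i j, i < j ∧ j ≤ 3 * A + 1 ∧ subT A σ i = 1 ∧ subT A σ j = 3 ∧ subH A σ i = subH A σ j := by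
  have hσ' := mem_subSlots.1 hσ
  refine ⟨A + 1, 3 * A + 1, by omega, le_rfl, ?_, ?_, ?_⟩ <;>
    simp only [subT, subH, stapleTN, stapleHN] <;> split_ifs <;> omega

/-! ### The walks -/

/-- The subStaple-extremal walks: `subStaple d A σ (v,w,x) i = H(i)·e₀ + (first T(i) of v, w, x)`. [cite: MadrasSlade1993, Definition 1.2.4] -/
def subStaple (d A σ : ℕ) (s : (Fin d × Bool) × (Fin d × Bool) × (Fin d × Bool)) (i : ℕ) : Site (d + 1) :=
  Pi.single 0 (subH A σ i : ℤ) + psum3 d s (subT A σ i)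

/-- Heights along `subStaple`: the table `subH`. [cite: MadrasSlade1993, Definition 1.2.4] -/
theorem subStaple_apply_zero (d A σ : ℕ) (s) (i : ℕ) : subStaple d A σ s i 0 = subH A σ i := by
  simp [subStaple]

/-- `subStaple` is frozen from index `3A + 1`. [cite: MadrasSlade1993, Definition 1.2.4] -/
theorem subStaple_of_le (d : ℕ) {A σ : ℕ} (hσ : σ ∈ subSlots A) (s) {i : ℕ} (hi : 3 * A + 1 ≤ i) :
    subStaple d A σ s i = subStaple d A σ s (3 * A + 1) := by
  obtain ⟨-, -, hH, hT, hfr⟩ := sub_table_ends hσ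
  obtain ⟨hH', hT'⟩ := hfr i hi
  rw [subStaple, subStaple, hH', hT', hH, hT]

/-- Consecutive sites of `subStaple` are lattice neighbours. [cite: MadrasSlade1993, Definition 1.2.4] -/
theorem subStaple_adj (d : ℕ) {A σ : ℕ} (hσ : σ ∈ subSlots A) (s) {i : ℕ} (hi : i < 3 * A + 1) :
    (zdGraph (d + 1)).Adj (subStaple d A σ s i) (subStaple d A σ s (i + 1)) := by
  rcases sub_table_step hσ (show i ≤ 3 * A by omega) with ⟨hH, hT⟩ | ⟨hH, hT⟩ | ⟨hH, hT, hT2⟩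
  · have : subStaple d A σ s (i + 1) = subStaple d A σ s i + Pi.single 0 1 := by
      rw [subStaple, subStaple, hT, hH, Nat.cast_add, Nat.cast_one, Pi.single_add]; abel
    rw [this]; exact adj_add_e0 d _
  · have : subStaple d A σ s i = subStaple d A σ s (i + 1) + Pi.single 0 1 := by
      rw [subStaple, subStaple, hT, ← hH, Nat.cast_add, Nat.cast_one, Pi.single_add]; abel
    rw [this]; exact (adj_add_e0 d _).symm
  · obtain ⟨a, ha⟩ := psum3_succ d s hT2
    have : subStaple d A σ s (i + 1) = subStaple d A σ s i + twoStepV d a := by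
      rw [subStaple, subStaple, hT, hH, ha]; abel
    rw [this]; exact adj_add_twoStepV d _ _

/-- `subStaple d A σ s`, `s ∈ fourStepIndex`, is a `(3A+1)`-step self-avoiding walk. [cite: MadrasSlade1993, Definition 1.2.4] -/
theorem subStaple_mem_saws (d : ℕ) {A σ : ℕ} (hσ : σ ∈ subSlots A) {s} (hs : s ∈ fourStepIndex d) :
    subStaple d A σ s ∈ saws (d + 1) (3 * A + 1) := by
  obtain ⟨hH0, hT0, -, -, -⟩ := sub_table_ends hσ
  refine mem_saws.2 ⟨?_, fun i hi => subStaple_of_le d hσ s (by omega), fun i hi => subStaple_adj d hσ s hi, ?_⟩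
  · rw [subStaple, hH0, hT0]; simp [psum3]
  · intro i hi j hj h
    simp only [Set.mem_setOf_eq] at hi hj
    have hH : subH A σ i = subH A σ j := by
      have := congrFun h 0
      rw [subStaple_apply_zero, subStaple_apply_zero] at this
      exact_mod_cast this
    have hP : psum3 d s (subT A σ i) = psum3 d s (subT A σ j) := by
      have h' : subStaple d A σ s i - Pi.single 0 (subH A σ i : ℤ) = subStaple d A σ s j - Pi.single 0 (subH A σ j : ℤ) := by rw [h, hH]
      simpa [subStaple] using h'
    have hT : subT A σ i = subT A σ j := psum3_inj d hs (sub_table_T_le i) (sub_table_T_le j) hP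
    exact sub_table_inj hσ hi hj hH hT

/-- `subStaple d A σ s` is a bridge of span `A`. [cite: MadrasSlade1993, Definition 1.2.4] -/
theorem subStaple_isBridge (d : ℕ) {A σ : ℕ} (hσ : σ ∈ subSlots A) (s) : IsBridge (3 * A + 1) (subStaple d A σ s) := by
  intro i h1 h7
  obtain ⟨hH0, -, hH7, -, -⟩ := sub_table_ends hσ
  obtain ⟨h1', h2'⟩ := sub_table_bridge hσ h1
  rw [subStaple_apply_zero, subStaple_apply_zero, subStaple_apply_zero, hH0, hH7]
  exact ⟨by exact_mod_cast h1', by exact_mod_cast h2'⟩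

/-- `subStaple d A σ s` is an irreducible bridge of cost `2A + 1`. [cite: DuminilCopinHammond2013, §2.2] -/
theorem subStaple_mem_filter (d : ℕ) {A σ : ℕ} (hσ : σ ∈ subSlots A) {s} (hs : s ∈ fourStepIndex d) :
    subStaple d A σ s ∈ (irreducibleBridges (d + 1) (3 * A + 1)).filter fun ω => costZd d (3 * A + 1) ω = 2 * A + 1 := by
  obtain ⟨-, -, hH7, -, -⟩ := sub_table_ends hσ
  refine Finset.mem_filter.2 ⟨mem_irreducibleBridges.2 ⟨mem_bridges.2 ⟨subStaple_mem_saws d hσ hs, subStaple_isBridge d hσ s⟩,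
    ⟨by omega, subStaple_isBridge d hσ s, fun k hk1 hk2 hren => ?_⟩⟩, ?_⟩
  · obtain ⟨-, hb1, hb2⟩ := hren
    refine sub_table_noRenewal hσ hk1 (by omega) ⟨fun i hi1 hi2 => ?_, fun j hj1 hj2 => ?_⟩
    · have := (hb1 i hi1 hi2).2
      rw [subStaple_apply_zero, subStaple_apply_zero] at this
      exact_mod_cast this
    · have := (hb2 j hj1 (by omega)).1
      simp only [add_zero, subStaple_apply_zero] at this
      exact_mod_cast this
  · simp only [costZd, subStaple_apply_zero, hH7, Int.toNat_natCast]
    omega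

/-! ### Injectivity, separation of the slots, and the lower bound -/

/-- `subStaple d A σ` is injective on step data. [cite: MadrasSlade1993, Definition 1.2.4] -/
theorem subStaple_injective (d : ℕ) {A σ : ℕ} (hσ : σ ∈ subSlots A) : Function.Injective (subStaple d A σ) := by
  rintro ⟨v, w, x⟩ ⟨v', w', x'⟩ h
  have hP : ∀ i, psum3 d (v, w, x) (subT A σ i) = psum3 d (v', w', x') (subT A σ i) := fun i => by
    have := congrFun h i
    simpa [subStaple] using this
  obtain ⟨⟨i1, -, hi1⟩, ⟨i2, -, hi2⟩⟩ := sub_table_T_hits hσ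
  obtain ⟨-, -, -, hT7, -⟩ := sub_table_ends hσ
  have h1 := hP i1
  rw [hi1] at h1
  simp only [psum3] at h1
  have hv : v = v' := twoStepV_injective d h1
  have h2 := hP i2
  rw [hi2] at h2
  simp only [psum3, hv, add_right_inj] at h2
  have hw : w = w' := twoStepV_injective d h2
  have h3 := hP (3 * A + 1)
  rw [hT7] at h3
  simp only [psum3, hv, hw, add_right_inj] at h3
  have hx : x = x' := twoStepV_injective d h3
  rw [hv, hw, hx]

/-- Walks of different slots are different (their height words differ; `A ≥ 2`). [cite: MadrasSlade1993, Definition 1.2.4] -/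
theorem subStaple_slot_eq (d : ℕ) {A σ σ' : ℕ} (hA : 2 ≤ A) (hσ : σ ∈ subSlots A) (hσ' : σ' ∈ subSlots A) {s s'}
    (h : subStaple d A σ s = subStaple d A σ' s') : σ = σ' := by
  refine sub_table_sep hA hσ hσ' fun i _ => ?_
  have := congrFun (congrFun h i) 0
  rw [subStaple_apply_zero, subStaple_apply_zero] at this
  exact_mod_cast this

/-- The `3A − 2` families lie in the cost-`(2A+1)` irreducible bridges of length `3A + 1` and are pairwise disjoint.
[cite: MadrasSlade1993, §4.2, remark after Theorem 4.2.4 (p. 94)] -/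
theorem biUnion_subStaple_subset (d A : ℕ) [DecidableEq (ℕ → Site (d + 1))] :
    ((subSlots A).biUnion fun σ => (fourStepIndex d).image (subStaple d A σ)) ⊆
      (irreducibleBridges (d + 1) (3 * A + 1)).filter fun ω => costZd d (3 * A + 1) ω = 2 * A + 1 := by
  intro ω h
  obtain ⟨σ, hσ, hω⟩ := Finset.mem_biUnion.1 h
  obtain ⟨s, hs, rfl⟩ := Finset.mem_image.1 hω
  exact subStaple_mem_filter d hσ hs

/-- The `3A − 2` families have `(3A − 2)·2d(2d−1)²` members in total (`A ≥ 2`). [cite: MadrasSlade1993, §4.2, remark after Theorem 4.2.4 (p. 94)] -/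
theorem card_biUnion_subStaple (d : ℕ) {A : ℕ} (hA : 2 ≤ A) [DecidableEq (ℕ → Site (d + 1))] :
    ((subSlots A).biUnion fun σ => (fourStepIndex d).image (subStaple d A σ)).card = (3 * A - 2) * (2 * d * (2 * d - 1) ^ 2) := by
  rw [Finset.card_biUnion]
  · have : ∀ σ ∈ subSlots A, ((fourStepIndex d).image (subStaple d A σ)).card = 2 * d * (2 * d - 1) ^ 2 := by
      intro σ hσ
      rw [Finset.card_image_of_injective _ (subStaple_injective d hσ), card_fourStepIndex]
    rw [Finset.sum_congr rfl this, Finset.sum_const, card_subSlots hA, smul_eq_mul]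
  · intro σ hσ σ' hσ' hne
    simp only [Function.onFun]
    rw [Finset.disjoint_left]
    intro ω hω hω'
    obtain ⟨s, -, rfl⟩ := Finset.mem_image.1 hω
    obtain ⟨s', -, h'⟩ := Finset.mem_image.1 hω'
    exact hne (subStaple_slot_eq d hA hσ hσ' h'.symm)

/-- ★ **`(3A − 2)·2d(2d−1)² ≤ N_{2A+1,3A+1}(ℤ^{d+1})`** for every `A ≥ 2` (with equality at `A = 2`: `costCoeffZd_five_seven`).
[cite: MadrasSlade1993, §4.2, remark after Theorem 4.2.4 (p. 94)] -/
theorem le_costCoeffZd_two_mul_add_one (d : ℕ) {A : ℕ} (hA : 2 ≤ A) :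
    (3 * A - 2) * (2 * d * (2 * d - 1) ^ 2) ≤ costCoeffZd d (2 * A + 1) (3 * A + 1) := by
  classical
  rw [costCoeffZd, ← card_biUnion_subStaple d hA]
  exact Finset.card_le_card (biUnion_subStaple_subset d A)

/-! ### The converse: every cost-`(2A+1)` irreducible bridge of length `3A + 1` is a subStaple-extremal walk -/

/-- A walk with the height word `subH A σ` (`σ ∈ subSlots A`) is `subStaple d A σ (v,w,x)` for the transverse steps `v, w, x` it takes at the
three transverse times of the table. [cite: MadrasSlade1993, §4.2, remark after Theorem 4.2.4 (p. 94)] -/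
theorem exists_eq_subStaple_of_heights (d : ℕ) {A σ : ℕ} (hσ : σ ∈ subSlots A) {ω : ℕ → Site (d + 1)}
    (hω : ω ∈ saws (d + 1) (3 * A + 1)) (hH : ∀ t, t ≤ 3 * A + 1 → ω t 0 = subH A σ t) :
    ∃ s, ∀ i, i ≤ 3 * A + 1 → ω i = subStaple d A σ s i := by
  obtain ⟨h0, -, hadj, -⟩ := mem_saws.1 hω
  obtain ⟨t₀, t₁, t₂, h01, h12, h2k, ⟨hT0, hT0', hH0⟩, ⟨hT1, hT1', hH1⟩, ⟨hT2, hT2', hH2⟩, htr⟩ := sub_table_tt hσ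
  obtain ⟨v, hv⟩ := exists_twoStepV_of_adj d (hadj t₀ (by omega))
    (by rw [hH (t₀ + 1) (by omega), hH t₀ (by omega)]; exact_mod_cast hH0)
  obtain ⟨w, hw⟩ := exists_twoStepV_of_adj d (hadj t₁ (by omega))
    (by rw [hH (t₁ + 1) (by omega), hH t₁ (by omega)]; exact_mod_cast hH1)
  obtain ⟨x, hx⟩ := exists_twoStepV_of_adj d (hadj t₂ (by omega))
    (by rw [hH (t₂ + 1) (by omega), hH t₂ (by omega)]; exact_mod_cast hH2)
  refine ⟨(v, w, x), fun i => ?_⟩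
  induction i with
  | zero =>
    intro _
    obtain ⟨hH00, hT00, -⟩ := sub_table_ends hσ
    rw [h0, subStaple, hH00, hT00]; simp [psum3]
  | succ i ih =>
    intro hi
    have prev := ih (by omega)
    rcases sub_table_step hσ (show i ≤ 3 * A by omega) with ⟨hHs, hTs⟩ | ⟨hHs, hTs⟩ | ⟨hHs, hTs, -⟩
    · have hup : ω (i + 1) 0 = ω i 0 + 1 := by rw [hH (i + 1) hi, hH i (by omega), hHs]; push_cast; ring
      rw [eq_add_e0_of_adj d (hadj i (by omega)) hup, prev, subStaple, subStaple, hTs, hHs, Nat.cast_add, Nat.cast_one, Pi.single_add]; abel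
    · have hdn : ω (i + 1) 0 = ω i 0 - 1 := by rw [hH (i + 1) hi, hH i (by omega), ← hHs]; push_cast; ring
      rw [eq_sub_e0_of_adj d (hadj i (by omega)) hdn, prev, subStaple, subStaple, hTs, ← hHs, Nat.cast_add, Nat.cast_one, Pi.single_add]; abel
    · rcases htr i (by omega) hTs with rfl | rfl | rfl
      · rw [hv, prev, subStaple, subStaple, hT0, hT0', hH0]; simp only [psum3]; abel
      · rw [hw, prev, subStaple, subStaple, hT1, hT1', hH1]; simp only [psum3]; abel
      · rw [hx, prev, subStaple, subStaple, hT2, hT2', hH2]; simp only [psum3]; abel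

/-- ★ **Every irreducible bridge of `ℤ^{d+1}` of length `3A + 1` and cost `2A + 1` (`A ≥ 2`) is `subStaple d A σ (v,w,x)`** for a slot
`σ ∈ subSlots A` and `(v,w,x) ∈ fourStepIndex` (the one-slack profile theorem, then the transverse steps; non-reversal by self-avoidance).
[cite: MadrasSlade1993, §4.2, remark after Theorem 4.2.4 (p. 94)] -/
theorem eq_subStaple_of_mem (d : ℕ) {A : ℕ} (hA : 2 ≤ A) {ω : ℕ → Site (d + 1)}
    (hω : ω ∈ (irreducibleBridges (d + 1) (3 * A + 1)).filter fun ω => costZd d (3 * A + 1) ω = 2 * A + 1) :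
    ∃ σ ∈ subSlots A, ∃ s ∈ fourStepIndex d, ω = subStaple d A σ s := by
  obtain ⟨hirr, hcost⟩ := Finset.mem_filter.1 hω
  obtain ⟨hbr, -⟩ := mem_irreducibleBridges.1 hirr
  obtain ⟨hωs, hb⟩ := mem_bridges.1 hbr
  obtain ⟨h0, hend, -, hinj⟩ := mem_saws.1 hωs
  have hspan : ω (3 * A + 1) 0 = A := by
    simp only [costZd] at hcost
    have := (span_le_and_cost_bound_zd hirr).1
    have hpos : 0 < ω (3 * A + 1) 0 := by have := (hb (3 * A + 1) (by omega) le_rfl).1; rwa [h0] at this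
    omega
  obtain ⟨σ, h1, h2, h3, h4, hH⟩ := heights_of_length_eq_three_mul_span_add_one d hirr hA hspan rfl
  have hσ : σ ∈ subSlots A := mem_subSlots.2 ⟨h2, h1, h3, h4⟩
  obtain ⟨s, hs⟩ := exists_eq_subStaple_of_heights d hσ hωs hH
  have hωeq : ω = subStaple d A σ s := by
    funext i
    rcases Nat.lt_or_ge i (3 * A + 2) with hi | hi
    · exact hs i (by omega)
    · rw [hend i (by omega), subStaple_of_le d hσ s (show 3 * A + 1 ≤ i by omega), hs (3 * A + 1) le_rfl]
  have hmem : ∀ i : ℕ, i ≤ 3 * A + 1 → i ∈ {j : ℕ | j ≤ 3 * A + 1} := fun i hi => hi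
  obtain ⟨v, w, x⟩ := s
  refine ⟨σ, hσ, (v, w, x), Finset.mem_filter.2 ⟨Finset.mem_univ _, ?_, ?_⟩, hωeq⟩
  · intro hwv
    obtain ⟨i, j, hij, hj, hTi, hTj, hHij⟩ := sub_table_vw hσ
    have he : ω i = ω j := by
      rw [hωeq, subStaple, subStaple, hTi, hTj, hHij]
      simp only [psum3]
      rw [show w = revIdx v from hwv, revIdx, twoStepV_not, add_neg_cancel, add_zero]
    have := hinj (hmem i (by omega)) (hmem j hj) he
    omega
  · intro hxw
    obtain ⟨i, j, hij, hj, hTi, hTj, hHij⟩ := sub_table_wx hσ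
    have he : ω i = ω j := by
      rw [hωeq, subStaple, subStaple, hTi, hTj, hHij]
      simp only [psum3]
      rw [show x = revIdx w from hxw, revIdx, twoStepV_not, add_assoc, add_neg_cancel, add_zero]
    have := hinj (hmem i (by omega)) (hmem j hj) he
    omega

/-- ★ The cost-`(2A+1)` irreducible bridges of length `3A + 1` are exactly the `3A − 2` subStaple-extremal families over `fourStepIndex`.
[cite: MadrasSlade1993, §4.2, remark after Theorem 4.2.4 (p. 94)] -/
theorem filter_costZd_subStaple_eq (d : ℕ) {A : ℕ} (hA : 2 ≤ A) [DecidableEq (ℕ → Site (d + 1))] :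
    ((irreducibleBridges (d + 1) (3 * A + 1)).filter fun ω => costZd d (3 * A + 1) ω = 2 * A + 1) =
      (subSlots A).biUnion fun σ => (fourStepIndex d).image (subStaple d A σ) := by
  refine Finset.Subset.antisymm (fun ω h => ?_) (biUnion_subStaple_subset d A)
  obtain ⟨σ, hσ, s, hs, rfl⟩ := eq_subStaple_of_mem d hA h
  exact Finset.mem_biUnion.2 ⟨σ, hσ, Finset.mem_image_of_mem _ hs⟩

/-- ★★ **`N_{2A+1,3A+1}(ℤ^{d+1}) = (3A − 2)·2d(2d−1)²` for every `A ≥ 2`**: the next-to-top coefficient of every odd cost polynomial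
of the large-force expansion (`A = 2`: `N_{5,7} = 4·2d(2d−1)²`, `costCoeffZd_five_seven`).
[cite: MadrasSlade1993, §4.2, remark after Theorem 4.2.4 (p. 94)] -/
theorem costCoeffZd_two_mul_add_one_three_mul_add_one (d : ℕ) {A : ℕ} (hA : 2 ≤ A) :
    costCoeffZd d (2 * A + 1) (3 * A + 1) = (3 * A - 2) * (2 * d * (2 * d - 1) ^ 2) := by
  classical
  rw [costCoeffZd, filter_costZd_subStaple_eq d hA, card_biUnion_subStaple d hA]

end Literature.Probability.RandomPlanarGeometry.SAW.Zd

end
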